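import Summits.BirchSwinnertonDyer.Rank1Residual.WAll.TargetCMTwoRamifiedTheta
import Summits.BirchSwinnertonDyer.Rank1Residual.P2.CongruentNumberThetaStarTowersBSD
import Summits.BirchSwinnertonDyer.Rank1Residual.P2.CongruentNumberThetaThreePrimesFamily
import Summits.BirchSwinnertonDyer.Rank1Residual.P2.CongruentNumberThetaThreePrimesBFamily
import Summits.BirchSwinnertonDyer.Rank1Residual.P2.CongruentNumberThetaThreePrimesCFamily
import Summits.BirchSwinnertonDyer.Rank1Residual.P2.CongruentNumberThetaThreePrimesDFamily
import Summits.BirchSwinnertonDyer.Rank1Residual.P2.CongruentNumberThetaThreePrimesEFamily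
import Summits.BirchSwinnertonDyer.Rank1Residual.P2.CornerFTwoPrintInterface
import Summits.BirchSwinnertonDyer.BirchSwinnertonDyer.Theorems.PrintCf2RamifiedOffTYZSMinusLeaf
import Summits.BirchSwinnertonDyer.BirchSwinnertonDyer.Theorems.PrintCf2RamifiedOffTYZAtlasFJLeaf
import Literature.NumberTheory.EllipticCurves.CongruentNumberEvenMonskySelmerExact
import HarnessLib

/-!
# Route `PrintCf2`, crux stmt-BirchSwinnertonDyer-20509 `RamifiedOffTYZOfFacts` — THE THETA-DESCENT FAMILIES OF CELL
# `bsd-monsky` CARVED OUT OF THE RESIDUAL: closer BY NAME beyond the bundle (TYZ Thm 1.1 + the §3.1–3.2 CM-point display),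
# the registered residual stub cut into «theta leaf ∨ six-way residual» (cell `bsd-print-cf2`, p1)

HONEST FRAMING (cell `bsd-print-cf2`; route `PrintCf2`; crux 20509 = `𝔅_ram → WAllCornerFTwoRamifiedOffTYZProved`, OPEN;
skeleton 58c6ad09: `stub_offTYZ_uPlusLeaf` (open in-bundle, LITERAL twin aside 20471) / `stub_offTYZ_sMinusLeaf` (LANDED
p546023) / `stub_offTYZ_residual` (five-way residual)): the five-way residual contains the THETA-DESCENT families of cell
`bsd-monsky` (prover-B; leaf `WAllCornerFTwoRamifiedTheta` of `WAll/TargetCMTwoRamifiedTheta.lean`: 𝒮⁻-towers / stars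
`2·q·p₁⋯p_m` and the three-prime shapes `557`, `377`, `355`, `157`, `135` of Monsky's C-P2-2 at `k = 3`), on which the tree
PROVES `ord_{s=1} L(E_n, s) = 1 ∧ rank 1 ∧ Ш[2^∞] = 0 ∧ BSD(E_n, 2)` (`P2.ThetaDescent.rankOne_sha_bsdp_two_tower_of_cmPointGaloisData`,
`…_557_family`, `…_377_family`, `…_355_family`, `…_157_family`, `…_135_family`) MODULO `hCM : tyz_cmPointGaloisData` (TYZ
§3.1–3.2 CM-point display, ∃-fact ⊋ `tyz_genusPointData`; OUTSIDE `𝔅_ram`), `h11 : thm11_parity_of_scriptL` (TYZ Thm 1.1 as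
printed; OUTSIDE `𝔅_ram`), `hGZK` (conjunct 1 of `𝔅_ram`) and Heath-Brown 1994's even Selmer count — a THEOREM of the tree
(`HeathBrown1994.monsky_card_selmerGroup_two_even_holds`), discharged here. So, exactly like the U⁺-road leaf, the theta leaf is
an ATTACKED SUB-SLICE of the residual closable BY NAME BEYOND the bundle (K7t doctrine: an `…OfFactsPlus` aside; TURNKEY
below), and the registered residual stub is CUT into «𝔅_ram → theta leaf» ∨ «𝔅_ram → six-way residual». CONTENTS: §1 the
closer `wAllCornerFTwoRamifiedTheta_of_facts (hCM) (h11) (hGZK)` (six-way case split; fact-free model transport); §2 the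
Plus-shaped closer `theta_of_bundlePlus : (𝔅_ram ∧ thm11 ∧ tyz_cmPointGaloisData) → WAllCornerFTwoRamifiedTheta` (the term of
the aside the planner files), the reduction `stub_offTYZ_residual ⇐ (𝔅_ram → theta leaf) + (𝔅_ram → six-way residual)`, and
the crux's conclusion from the five-leaf stub set. TURNKEY (-plan): aside
`RamifiedThetaOfFactsPlus := ((Literature.NumberTheory.EllipticCurves.rank_eq_analyticRank_of_analyticRank_le_one ∧ WeierstrassCurve.hasEntireLFunction_rat ∧ WeierstrassCurve.bsdRHS_eq_of_isIsogenous ∧ Literature.NumberTheory.EllipticCurves.bsdTriple_of_hasCM_of_L_one_ne_zero ∧ Literature.NumberTheory.EllipticCurves.TianYuanZhang2017.thm12_parity_of_scriptL' ∧ Literature.NumberTheory.EllipticCurves.Tian2014.thm13_rank_one_and_sha_odd ∧ Literature.NumberTheory.QuadraticFields.RedeiReichardt.redeiReichardt_fourTwoCard_classGroup ∧ Literature.NumberTheory.EllipticCurves.LiLiuTian2024.thm12_bsd_congruentNumberCurve ∧ Literature.NumberTheory.EllipticCurves.Monsky1990.cor515_rank_eq_one_and_card_selmerGroup_two ∧ Literature.NumberTheory.EllipticCurves.HeathBrown1994.monsky_card_selmerGroup_two_even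 ∧ Literature.NumberTheory.EllipticCurves.Tian2014.tian2014_system_sMinus_genus) ∧ Literature.NumberTheory.EllipticCurves.TianYuanZhang2017.thm11_parity_of_scriptL ∧
Literature.NumberTheory.EllipticCurves.TianYuanZhang2017.tyz_cmPointGaloisData) → Summit.BirchSwinnertonDyer.WAllCornerFTwoRamifiedTheta`,
closed by `fun h ↦ Summit.BirchSwinnertonDyer.PrintCf2.theta_of_bundlePlus h`; by-name fact asides for the two extra facts
(`TYZThm11ParityOfScriptL := …thm11_parity_of_scriptL`, `TYZCMPointGaloisData := …tyz_cmPointGaloisData`) for the staffable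
rule. No route file imported. Nothing asserted. Beyond print: YES (Monsky 1990 p. 67 Rem. (3) conjectures the two-prime case
only; no printed statement for the towers or the `k = 3` shapes; tree theorems modulo the displays; booking currency
LITERAL-by-name(hCM)).
[cite: Monsky1990MockHeegner, p. 67 Remark (3)] [cite: TianYuanZhang2017, Thm. 1.1, §1 (1.1), Thm. 3.5, Thm. 3.6]
[cite: HeathBrown1994SelmerCongruentII, Appendix (Monsky), typescript p. 41 L20–L36] [cite: Miller2011LMS, Def. 1.1 (arXiv:1010.2431 p. 3)]
-/

noncomputable section

open scoped Classical

open WeierstrassCurve Summit.BirchSwinnertonDyer Summit.BirchSwinnertonDyer.Rank1Residual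
  Literature.NumberTheory.EllipticCurves Literature.NumberTheory.EllipticCurves.Rank1Residual
  Literature.NumberTheory.EllipticCurves.TianYuanZhang2017

set_option autoImplicit false

namespace Summit.BirchSwinnertonDyer.PrintCf2

/-! ## §1 CLOSER BY NAME of the leaf `WAllCornerFTwoRamifiedTheta` (beyond the bundle) -/

/-- **CLOSER of the theta leaf**, modulo the TYZ §3.1–3.2 CM-point display (`hCM`), TYZ Thm 1.1 as printed (`h11`) and GZK
(`hGZK`); Heath-Brown 1994's even count is the tree theorem `monsky_card_selmerGroup_two_even_holds`; six-way case split on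
the membership disjuncts, each closed by the named `P2.ThetaDescent` theorem of cell `bsd-monsky` and moved to every globally
minimal `ℚ`-model fact-free (`CornerFTwo.CongruentNumber.analyticRank_eq_one_and_bsdp_two_of_smul`). The leaf's hypotheses
`HasCM`, `r_an = 1`, `CMRamified` are not used (they HOLD on the families). [cite: TianYuanZhang2017, Thm. 1.1, Thm. 3.5, Thm. 3.6]
[cite: HeathBrown1994SelmerCongruentII, Appendix (Monsky), typescript p. 41 L20–L36] [cite: Miller2011LMS, Def. 1.1 (arXiv:1010.2431 p. 3)] -/
theorem wAllCornerFTwoRamifiedTheta_of_facts (hCM : tyz_cmPointGaloisData) (h11 : thm11_parity_of_scriptL)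
    (hGZK : rank_eq_analyticRank_of_analyticRank_le_one) : WAllCornerFTwoRamifiedTheta := by
  have hMe := HeathBrown1994.monsky_card_selmerGroup_two_even_holds
  intro W _ _ _ _ _ hmem
  rcases hmem with ⟨m, q, p, hq, hq4, hp, hp5, hinj, hQR, hμ, hmark, C, hC⟩ |
      ⟨p₁, p₂, p₃, hp₁, hp₂, hp₃, h₁, h₂, h₃, h12, hj, C, hC⟩ |
      ⟨p₁, p₂, p₃, hp₁, hp₂, hp₃, h₁, h₂, h₃, h23, hj, hk, C, hC⟩ |
      ⟨p₁, p₂, p₃, hp₁, hp₂, hp₃, h₁, h₂, h₃, h23, hj, C, hC⟩ |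
      ⟨p₁, p₂, p₃, hp₁, hp₂, hp₃, h₁, h₂, h₃, hj, C, hC⟩ |
      ⟨p₁, p₂, p₃, hp₁, hp₂, hp₃, h₁, h₂, h₃, hj, C, hC⟩
  · have h := P2.ThetaDescent.rankOne_sha_bsdp_two_tower_of_cmPointGaloisData hCM hGZK hMe h11 hq hq4 hp hp5 hinj hQR hμ
      hmark
    exact (P2.CornerFTwo.CongruentNumber.analyticRank_eq_one_and_bsdp_two_of_smul
      (squarefree_of_thetaTower hq hq4 hp hp5 hinj) ⟨h.1, h.2.2.2⟩ hC).2
  · have h := P2.ThetaDescent.rankOne_sha_bsdp_two_two_mul_557_family hCM hGZK hMe p₁ p₂ p₃ hp₁ hp₂ hp₃ h₁ h₂ h₃ h12 hj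
    exact (P2.CornerFTwo.CongruentNumber.analyticRank_eq_one_and_bsdp_two_of_smul
      (squarefree_two_mul_three_primes hp₁ hp₂ hp₃ (by omega) (by omega) (by omega) h12 (by omega) (by omega))
      ⟨h.1, h.2.2.2⟩ hC).2
  · have h := P2.ThetaDescent.rankOne_sha_bsdp_two_two_mul_377_family hCM h11 hGZK hMe p₁ p₂ p₃ hp₁ hp₂ hp₃ h₁ h₂ h₃
      h23 hj hk
    exact (P2.CornerFTwo.CongruentNumber.analyticRank_eq_one_and_bsdp_two_of_smul
      (squarefree_two_mul_three_primes hp₁ hp₂ hp₃ (by omega) (by omega) (by omega) (by omega) (by omega) h23)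
      ⟨h.1, h.2.2.2⟩ hC).2
  · have h := P2.ThetaDescent.rankOne_sha_bsdp_two_two_mul_355_family hCM h11 hGZK hMe p₁ p₂ p₃ hp₁ hp₂ hp₃ h₁ h₂ h₃
      h23 hj
    exact (P2.CornerFTwo.CongruentNumber.analyticRank_eq_one_and_bsdp_two_of_smul
      (squarefree_two_mul_three_primes hp₁ hp₂ hp₃ (by omega) (by omega) (by omega) (by omega) (by omega) h23)
      ⟨h.1, h.2.2.2⟩ hC).2
  · have h := P2.ThetaDescent.rankOne_sha_bsdp_two_two_mul_157_family hCM h11 hGZK hMe p₁ p₂ p₃ hp₁ hp₂ hp₃ h₁ h₂ h₃ hj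
    exact (P2.CornerFTwo.CongruentNumber.analyticRank_eq_one_and_bsdp_two_of_smul
      (squarefree_two_mul_three_primes hp₁ hp₂ hp₃ (by omega) (by omega) (by omega) (by omega) (by omega) (by omega))
      ⟨h.1, h.2.2.2⟩ hC).2
  · have h := P2.ThetaDescent.rankOne_sha_bsdp_two_two_mul_135_family hCM h11 hGZK hMe p₁ p₂ p₃ hp₁ hp₂ hp₃ h₁ h₂ h₃ hj
    exact (P2.CornerFTwo.CongruentNumber.analyticRank_eq_one_and_bsdp_two_of_smul
      (squarefree_two_mul_three_primes hp₁ hp₂ hp₃ (by omega) (by omega) (by omega) (by omega) (by omega) (by omega))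
      ⟨h.1, h.2.2.2⟩ hC).2

/-! ## §2 The Plus-shaped closer, the cut of the registered residual stub, and the crux's conclusion -/

/-- **The theta leaf from the bundle PLUS the two displayed facts** — the term of the `…OfFactsPlus` aside the planner files
(antecedent `𝔅_ram ∧ thm11_parity_of_scriptL ∧ tyz_cmPointGaloisData`; uses conjunct 1 of `𝔅_ram` and the two extras).
[cite: TianYuanZhang2017, Thm. 1.1, Thm. 3.5, Thm. 3.6] [cite: Miller2011LMS, Def. 1.1] -/
theorem theta_of_bundlePlus
    (h : (Literature.NumberTheory.EllipticCurves.rank_eq_analyticRank_of_analyticRank_le_one ∧ WeierstrassCurve.hasEntireLFunction_rat ∧ WeierstrassCurve.bsdRHS_eq_of_isIsogenous ∧ Literature.NumberTheory.EllipticCurves.bsdTriple_of_hasCM_of_L_one_ne_zero ∧ Literature.NumberTheory.EllipticCurves.TianYuanZhang2017.thm12_parity_of_scriptL' ∧ Literature.NumberTheory.EllipticCurves.Tian2014.thm13_rank_one_and_sha_odd ∧ Literature.NumberTheory.QuadraticFields.RedeiReichardt.redeiReichardt_fourTwoCard_classGroup ∧ Literature.NumberTheory.EllipticCurves.LiLiuTian2024.thm12_bsd_congruentNumberCurve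 ∧ Literature.NumberTheory.EllipticCurves.Monsky1990.cor515_rank_eq_one_and_card_selmerGroup_two ∧ Literature.NumberTheory.EllipticCurves.HeathBrown1994.monsky_card_selmerGroup_two_even ∧ Literature.NumberTheory.EllipticCurves.Tian2014.tian2014_system_sMinus_genus) ∧ Literature.NumberTheory.EllipticCurves.TianYuanZhang2017.thm11_parity_of_scriptL ∧
      Literature.NumberTheory.EllipticCurves.TianYuanZhang2017.tyz_cmPointGaloisData) :
    Summit.BirchSwinnertonDyer.WAllCornerFTwoRamifiedTheta :=
  wAllCornerFTwoRamifiedTheta_of_facts h.2.2 h.2.1 h.1.1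

/-- **The REGISTERED residual stub `stub_offTYZ_residual` (𝔅_ram ⟹ five-way residual, skeleton 58c6ad09) is CUT**: it follows
from «𝔅_ram ⟹ theta leaf» (closable beyond the bundle, `theta_of_bundlePlus`) and «𝔅_ram ⟹ six-way residual» (OPEN, no
print). [folklore] -/
theorem stub_offTYZ_residual_of_theta_of_off
    (hT : (Literature.NumberTheory.EllipticCurves.rank_eq_analyticRank_of_analyticRank_le_one ∧ WeierstrassCurve.hasEntireLFunction_rat ∧ WeierstrassCurve.bsdRHS_eq_of_isIsogenous ∧ Literature.NumberTheory.EllipticCurves.bsdTriple_of_hasCM_of_L_one_ne_zero ∧ Literature.NumberTheory.EllipticCurves.TianYuanZhang2017.thm12_parity_of_scriptL' ∧ Literature.NumberTheory.EllipticCurves.Tian2014.thm13_rank_one_and_sha_odd ∧ Literature.NumberTheory.QuadraticFields.RedeiReichardt.redeiReichardt_fourTwoCard_classGroup ∧ Literature.NumberTheory.EllipticCurves.LiLiuTian2024.thm12_bsd_congruentNumberCurve ∧ Literature.NumberTheory.EllipticCurves.Monsky1990.cor515_rank_eq_one_and_card_selmerGroup_two ∧ Literature.NumberTheory.EllipticCurves.HeathBrown1994.monsky_card_selmerGroup_two_even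 ∧ Literature.NumberTheory.EllipticCurves.Tian2014.tian2014_system_sMinus_genus) → Summit.BirchSwinnertonDyer.WAllCornerFTwoRamifiedTheta)
    (hO : (Literature.NumberTheory.EllipticCurves.rank_eq_analyticRank_of_analyticRank_le_one ∧ WeierstrassCurve.hasEntireLFunction_rat ∧ WeierstrassCurve.bsdRHS_eq_of_isIsogenous ∧ Literature.NumberTheory.EllipticCurves.bsdTriple_of_hasCM_of_L_one_ne_zero ∧ Literature.NumberTheory.EllipticCurves.TianYuanZhang2017.thm12_parity_of_scriptL' ∧ Literature.NumberTheory.EllipticCurves.Tian2014.thm13_rank_one_and_sha_odd ∧ Literature.NumberTheory.QuadraticFields.RedeiReichardt.redeiReichardt_fourTwoCard_classGroup ∧ Literature.NumberTheory.EllipticCurves.LiLiuTian2024.thm12_bsd_congruentNumberCurve ∧ Literature.NumberTheory.EllipticCurves.Monsky1990.cor515_rank_eq_one_and_card_selmerGroup_two ∧ Literature.NumberTheory.EllipticCurves.HeathBrown1994.monsky_card_selmerGroup_two_even ∧ Literature.NumberTheory.EllipticCurves.Tian2014.tian2014_system_sMinus_genus) → Summit.BirchSwinnertonDyer.WAllCornerFTwoRamifiedOffTYZOffSMinusOffTheta)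 :
    (Literature.NumberTheory.EllipticCurves.rank_eq_analyticRank_of_analyticRank_le_one ∧ WeierstrassCurve.hasEntireLFunction_rat ∧ WeierstrassCurve.bsdRHS_eq_of_isIsogenous ∧ Literature.NumberTheory.EllipticCurves.bsdTriple_of_hasCM_of_L_one_ne_zero ∧ Literature.NumberTheory.EllipticCurves.TianYuanZhang2017.thm12_parity_of_scriptL' ∧ Literature.NumberTheory.EllipticCurves.Tian2014.thm13_rank_one_and_sha_odd ∧ Literature.NumberTheory.QuadraticFields.RedeiReichardt.redeiReichardt_fourTwoCard_classGroup ∧ Literature.NumberTheory.EllipticCurves.LiLiuTian2024.thm12_bsd_congruentNumberCurve ∧ Literature.NumberTheory.EllipticCurves.Monsky1990.cor515_rank_eq_one_and_card_selmerGroup_two ∧ Literature.NumberTheory.EllipticCurves.HeathBrown1994.monsky_card_selmerGroup_two_even ∧ Literature.NumberTheory.EllipticCurves.Tian2014.tian2014_system_sMinus_genus) → Summit.BirchSwinnertonDyer.WAllCornerFTwoRamifiedOffTYZOffSMinus :=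
  fun hB ↦ wAllCornerFTwoRamifiedOffTYZOffSMinus_of_theta_of_off (hT hB) (hO hB)

/-- **The crux's conclusion from the five-leaf stub set** — U⁺ leaf (hypothesis; aside 20471), FJ atlas (landed p541735),
`𝒮⁻` (landed p546023), theta leaf (hypothesis; Plus aside), six-way residual (hypothesis; OPEN). [folklore] -/
theorem offTYZProved_of_bundle_of_uPlus_of_theta_of_off (hB : (Literature.NumberTheory.EllipticCurves.rank_eq_analyticRank_of_analyticRank_le_one ∧ WeierstrassCurve.hasEntireLFunction_rat ∧ WeierstrassCurve.bsdRHS_eq_of_isIsogenous ∧ Literature.NumberTheory.EllipticCurves.bsdTriple_of_hasCM_of_L_one_ne_zero ∧ Literature.NumberTheory.EllipticCurves.TianYuanZhang2017.thm12_parity_of_scriptL' ∧ Literature.NumberTheory.EllipticCurves.Tian2014.thm13_rank_one_and_sha_odd ∧ Literature.NumberTheory.QuadraticFields.RedeiReichardt.redeiReichardt_fourTwoCard_classGroup ∧ Literature.NumberTheory.EllipticCurves.LiLiuTian2024.thm12_bsd_congruentNumberCurve ∧ Literature.NumberTheory.EllipticCurves.Monsky1990.cor515_rank_eq_one_and_card_selmerGroup_two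 ∧ Literature.NumberTheory.EllipticCurves.HeathBrown1994.monsky_card_selmerGroup_two_even ∧ Literature.NumberTheory.EllipticCurves.Tian2014.tian2014_system_sMinus_genus))
    (hU : WAllCornerFTwoRamifiedTYZUPlus) (hT : WAllCornerFTwoRamifiedTheta)
    (hO : WAllCornerFTwoRamifiedOffTYZOffSMinusOffTheta) : WAllCornerFTwoRamifiedOffTYZProved :=
  wAllCornerFTwoRamifiedOffTYZProved_of_uPlus_of_atlasFJ_of_sMinus_of_theta_of_off hU (stub_offTYZ_atlasFJLeaf hB)
    (stub_offTYZ_sMinusLeaf hB) hT hO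

end Summit.BirchSwinnertonDyer.PrintCf2

end
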